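import Mathlib

/-!
# The modular line is decided at finite `p`-adic order (solo-informed, §7.11 (16.9)(a))

Elementary arithmetic behind Proposition (16.9)(a) of Part II.  Let `𝕋_𝔪 = ℤ_p[X]/(X² − pX)` be the
Hecke algebra of a single depth-one `[1,1]` Eisenstein congruence.  Its local points with values in
`ℤ/p^M` are `X ↦ u` with `p ∣ u` and `u² ≡ p u (mod p^M)`.

* `soloInformed_heckePoint_mod_sq` : modulo `p²` EVERY `u = p c` is a point — order two selects nothing
  ((16.9)(a)(i) on the Hecke side).
* `soloInformed_heckePoint_mod_cube` : modulo `p³` a point `u = p c` has `c ≡ 0` or `c ≡ 1 (mod p)` — only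
  the Eisenstein point and the cusp form survive ((16.9)(a)(iii), the step `S_{N+3} = {0, x_f}`).
* `soloInformed_torsion_kernel_mod_sq` : if `p^N` kills an element `t` of the kernel of `R ↠ 𝕋_𝔪` and
  `φ : R → ℤ/p^(N+2)`, then `φ(t) ∈ (p²)`; in integers: `p^(N+2) ∣ p^N u → p² ∣ u`.  This is why a
  `ℤ/p^(N+2)`-point of `R` factors through `𝕋_𝔪` modulo `p²` ((16.9)(a)(iii), line selection at order `N + 2`),
  and `soloInformed_torsion_kernel_mod_cube` is the order-`N + 3` version used for vector selection.
-/

namespace Summit.Langlands.Langlands.Theorems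

/-- Order two selects nothing: every `u = p c` satisfies `u² ≡ p u (mod p²)`. -/
theorem soloInformed_heckePoint_mod_sq (p c : ℤ) : p ^ 2 ∣ (p * c) ^ 2 - p * (p * c) :=
  ⟨c ^ 2 - c, by ring⟩

/-- Order three selects the two modular points: if `u = p c` satisfies `u² ≡ p u (mod p³)` with `p`
prime, then `c ≡ 0` or `c ≡ 1 (mod p)`. -/
theorem soloInformed_heckePoint_mod_cube {p : ℤ} (hp : Prime p) (c : ℤ)
    (h : p ^ 3 ∣ (p * c) ^ 2 - p * (p * c)) : p ∣ c ∨ p ∣ c - 1 := by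
  have e1 : (p * c) ^ 2 - p * (p * c) = p ^ 2 * (c * (c - 1)) := by ring
  have e2 : p ^ 3 = p ^ 2 * p := by ring
  rw [e1, e2] at h
  have hp2 : p ^ 2 ≠ 0 := pow_ne_zero 2 hp.ne_zero
  have hdiv : p ∣ c * (c - 1) := (mul_dvd_mul_iff_left hp2).mp h
  exact hp.dvd_or_dvd hdiv

/-- Conversely both modular points are points to every order: `c = 0` and `c = 1` give `u² = p u`
exactly. -/
theorem soloInformed_heckePoint_modular (p : ℤ) :
    (p * 0) ^ 2 - p * (p * 0) = 0 ∧ (p * 1) ^ 2 - p * (p * 1) = 0 := by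
  constructor <;> ring

/-- The torsion kernel is invisible modulo `p²` at order `N + 2`: `p^(N+2) ∣ p^N u → p² ∣ u`. -/
theorem soloInformed_torsion_kernel_mod_sq {p : ℤ} (hp : p ≠ 0) (N : ℕ) {u : ℤ}
    (h : p ^ (N + 2) ∣ p ^ N * u) : p ^ 2 ∣ u := by
  rw [pow_add] at h
  exact (mul_dvd_mul_iff_left (pow_ne_zero N hp)).mp h

/-- … and modulo `p³` at order `N + 3`: `p^(N+3) ∣ p^N u → p³ ∣ u`. -/
theorem soloInformed_torsion_kernel_mod_cube {p : ℤ} (hp : p ≠ 0) (N : ℕ) {u : ℤ}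
    (h : p ^ (N + 3) ∣ p ^ N * u) : p ^ 3 ∣ u := by
  rw [pow_add] at h
  exact (mul_dvd_mul_iff_left (pow_ne_zero N hp)).mp h

/-- The two steps combined ((16.9)(a)(iii)): if `p^N` kills the kernel and a point `u = p c` of `R`
modulo `p^(N+3)` reduces, modulo `p³`, to a point of `𝕋_𝔪` — i.e. `p^(N+3) ∣ p^N ((p c)² − p (p c))` —
then `c ≡ 0` or `1 (mod p)`: the modular VECTOR is decided at order `N + 3`. -/
theorem soloInformed_vector_selected_at_finite_order {p : ℤ} (hp : Prime p) (N : ℕ) (c : ℤ)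
    (h : p ^ (N + 3) ∣ p ^ N * ((p * c) ^ 2 - p * (p * c))) : p ∣ c ∨ p ∣ c - 1 :=
  soloInformed_heckePoint_mod_cube hp c (soloInformed_torsion_kernel_mod_cube hp.ne_zero N h)

end Summit.Langlands.Langlands.Theorems
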